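import Summits.RiemannHypothesis.RiemannHypothesis.Theorems.WeilFormatCDeflatedFarDoor
import HarnessLib

/-!
# Format C, design C∞: the front door with NO profiles is the plain two-level door with a margin (consistency instance)

Route context: Fourier–Galerkin / Schur-complement certificates of Weil positivity on a window ("format C";
cell memo `run/shared/lean/pub/rh-explicit/rh-explicit-weil-10/KERNEL-LEVER.md` §19; supporting stmt-RiemannHypothesis-0098;
seat rh-explicit-weil-10).

Sanity / template instance of the C∞ front door `weilPositivityOn_of_formatC_cinf`: with `r = 0` profiles in both sectors
every profile hypothesis is vacuous, every limit object is an empty sum, and the door collapses to the plain two-level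
certificate (block Gram `−` coupling majorant `≥ δ‖x‖²`) — the shape of `weilPositivityOn_of_formatC_kernelsA` with a strict
margin.  This shows the C∞ door's data hypotheses are jointly satisfiable in the familiar way and gives the door generator
its degenerate test case.

* `weilPositivityOn_of_formatC_cinf_noProfiles`.

Standard axioms; no definitions; no RH claim beyond the stated case.
-/

set_option autoImplicit false
-- `Summit.RiemannHypothesis.RiemannHypothesis.…` is the layout-mandated namespace (summit = problem name).
set_option linter.dupNamespace false

noncomputable section

open Complex Filter Set MeasureTheory Finset
open scoped Real Topology ComplexConjugate

namespace Summit.RiemannHypothesis.RiemannHypothesis.Theorems.WeilFormatC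

open Literature.NumberTheory.LFunctions Literature.NumberTheory.LFunctions.Yoshida1992

variable {a : ℝ}

/-- **The C∞ front door without profiles** (`r = 0` in both sectors): per sector a block, a data far diagonal with floor
`d₀ > 0` and far inequality, a majorant `U` of the block coupling `Σ_{m∈[B,N)} (Σ_i M(i,m)x_i)²/d̂_m` for every `N`, and the
block inequality `δΣx² ≤ Σ x x M − U(x)` with `δ > 0` ⟹ `WeilPositivityOn a`. -/
theorem weilPositivityOn_of_formatC_cinf_noProfiles (ha : 0 < a)
    -- EVEN sector (block `Fin (Be + 1)`)
    (Be : ℕ) (de : ℕ → ℝ) {d₀e : ℝ} (hde₀ : 0 < d₀e) (hde : ∀ m, Be + 1 ≤ m → d₀e ≤ de m)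
    (hfare : ∀ (N : ℕ) (y : ℕ → ℝ),
      ∑ n ∈ Finset.Ico (Be + 1) N, de n * y n ^ 2 ≤ ∑ n ∈ Finset.Ico (Be + 1) N, ∑ m ∈ Finset.Ico (Be + 1) N,
        y n * (if n = 0 then gramCoeff a 0 m else if m = 0 then gramCoeff a n 0
          else (gramCoeff a n m + gramCoeff a n (-(m : ℤ))) / 2) * y m)
    (Ue : (Fin (Be + 1) → ℝ) → ℝ)
    (hUe : ∀ (N : ℕ) (x : Fin (Be + 1) → ℝ),
      ∑ m ∈ Finset.Ico (Be + 1) N,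
        (∑ i : Fin (Be + 1), (if (i : ℕ) = 0 then gramCoeff a 0 m else if m = 0 then gramCoeff a i 0
            else (gramCoeff a i m + gramCoeff a i (-(m : ℤ))) / 2) * x i) ^ 2 / de m ≤ Ue x)
    {δe : ℝ} (hδe : 0 < δe)
    (hSe : ∀ x : Fin (Be + 1) → ℝ,
      δe * ∑ i, x i ^ 2 ≤
        (∑ i : Fin (Be + 1), ∑ i' : Fin (Be + 1), x i * x i' *
            (if (i : ℕ) = 0 then gramCoeff a 0 i' else if (i' : ℕ) = 0 then gramCoeff a i 0
              else (gramCoeff a i i' + gramCoeff a i (-(i' : ℤ))) / 2)) - Ue x)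
    -- ODD sector (block `Fin Bo`)
    {Bo : ℕ} (hBo : 1 ≤ Bo) (dod : ℕ → ℝ) {d₀o : ℝ} (hdo₀ : 0 < d₀o) (hdo : ∀ m, Bo ≤ m → d₀o ≤ dod m)
    (hfaro : ∀ (N : ℕ) (z : ℕ → ℝ),
      ∑ k ∈ Finset.Ico Bo N, dod k * z k ^ 2 ≤ ∑ k ∈ Finset.Ico Bo N, ∑ l ∈ Finset.Ico Bo N,
        z k * ((gramCoeff a ((k : ℤ) + 1) ((l : ℤ) + 1) - gramCoeff a ((k : ℤ) + 1) (-((l : ℤ) + 1))) / 2) * z l)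
    (Uo : (Fin Bo → ℝ) → ℝ)
    (hUo : ∀ (N : ℕ) (x : Fin Bo → ℝ),
      ∑ m ∈ Finset.Ico Bo N,
        (∑ i : Fin Bo, ((gramCoeff a (((i : ℕ) : ℤ) + 1) ((m : ℤ) + 1) - gramCoeff a (((i : ℕ) : ℤ) + 1) (-((m : ℤ) + 1))) / 2)
            * x i) ^ 2 / dod m ≤ Uo x)
    {δo : ℝ} (hδo : 0 < δo)
    (hSo : ∀ x : Fin Bo → ℝ,
      δo * ∑ i, x i ^ 2 ≤
        (∑ i : Fin Bo, ∑ i' : Fin Bo, x i * x i' *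
            ((gramCoeff a (((i : ℕ) : ℤ) + 1) (((i' : ℕ) : ℤ) + 1)
              - gramCoeff a (((i : ℕ) : ℤ) + 1) (-((((i' : ℕ) : ℤ)) + 1))) / 2)) - Uo x) :
    WeilPositivityOn a := by
  refine weilPositivityOn_of_formatC_cinf ha Be (re := 0) (fun j ↦ Fin.elim0 j) (fun j ↦ Fin.elim0 j) (fun j ↦ Fin.elim0 j)
    (fun j ↦ Fin.elim0 j) (fun j ↦ Fin.elim0 j) de hde₀ hde hfare (fun _ _ j ↦ Fin.elim0 j) (lame := 0) le_rfl
    (fun x β ↦ by simp) (fun x _ ↦ Ue x) (fun N x β ↦ by simpa using hUe N x) hδe (fun x β ↦ by simpa using hSe x)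
    hBo (ro := 0) (fun j ↦ Fin.elim0 j) (fun j ↦ Fin.elim0 j) (fun j ↦ Fin.elim0 j) (fun j ↦ Fin.elim0 j) (fun j ↦ Fin.elim0 j)
    (fun j ↦ Fin.elim0 j) dod hdo₀ hdo hfaro (fun _ _ j ↦ Fin.elim0 j) (lamo := 0) le_rfl
    (fun x β ↦ by simp) (fun x _ ↦ Uo x) (fun N x β ↦ by simpa using hUo N x) hδo (fun x β ↦ by simpa using hSo x)

end Summit.RiemannHypothesis.RiemannHypothesis.Theorems.WeilFormatC

end
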